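import Mathlib
import Literature.NumberTheory.Irrationality.Fischler2002.JnPsiProofs
import HarnessLib

/-!
# Fischler 2002 §2: the change of variables of Théorème 2.1 (`𝒦(p) = 𝓛(P)`) — the substitution theorem, for every `n`

Topic `Literature/NumberTheory/Irrationality/Fischler2002`; proofs-only companion of `BeukersSorokinChangeOfVariables.lean`
(first file toward discharging its NAMED FACT `theoreme21`). Cell `pub-zeta5`, seat ct-1 g30, 2026-08-27. Source: S. Fischler,
« Formes linéaires en polyzêtas et intégrales multiples », C. R. Acad. Sci. Paris Sér. I **335** (2002) 1–4 = arXiv:math/0202064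
[Fischler2002Polyzetas], §2 Théorème 2.1: "Ce résultat provient du changement de variables défini par `x_k = X_{n+1−k}` pour
`k ≡ n mod 2` et `x_k = (1 − X₁…X_{n−k})X_{n+1−k}/(1 − X₁…X_{n+1−k})` pour `k ≢ n mod 2`" (journal version: S. Fischler,
*Groupes de Rhin-Viola et intégrales multiples*, J. Théor. Nombres Bordeaux **15** (2003) 479–534 [Fischler2003RhinViola], §5).

HONEST FRAMING (cells pub-zeta5 / zeta5-irr): systematic search; no irrationality claim unless certified. Identities between
(possibly infinite) `n`-fold integrals of non-negative functions; not an irrationality statement; nothing about `ζ(5)`.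

## Content (theorems only; no definition, no new named fact)
In the REVERSED variables `y_j = x_{n+1−j}` Fischler's map is TRIANGULAR and dimension-free: `y_j = X_j` for odd `j` and
`y_j = (1 − Π_{j−1})X_j/(1 − Π_j)` for even `j`, `Π_j = X₁⋯X_j` (`headProduct`), a Möbius self-map of `(0,1)` in `X_j` for fixed
`X₁,…,X_{j−1}`, with `∂y_j/∂X_j = (1 − Π_{j−1})/(1 − Π_j)²`. This file proves, for every `n` and every measurable `G ≥ 0`,
`∫⁻_{(0,1)^n} G(y) dy = ∫⁻_{(0,1)^n} G(Y(X)) · ∏_{j ≤ n even} (1 − Π_{j−1})/(1 − Π_j)² dX` (`lintegral_cube_eq_lintegral_moebius`)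
by INDUCTION on `n` (the last variable innermost, `JnChi.lintegral_openCube_succ`; the one-dimensional Möbius substitution
`lintegral_Ioo_moebius` from `lintegral_image_eq_lintegral_abs_deriv_mul`) — no `n × n` Jacobian — and the reversal invariance
of the cube (`lintegral_cube_rev`). The map and the weight are not given names (written out with `headProduct`).
-/

noncomputable section

namespace Literature.NumberTheory.Irrationality.Fischler2002

open MeasureTheory Set Finset
open scoped ENNReal

namespace KL

open JnChi JnPsi

/-! ### Head products `Π_k = X₁⋯X_k` -/

/-- `Π₀ = 1`. [cite: Fischler2002Polyzetas, §2 p. 2 (definition of 𝓛(P))] -/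
theorem headProduct_zero {m : ℕ} (X : Fin m → ℝ) : headProduct X 0 = 1 := by
  unfold headProduct
  rw [show (Finset.Icc 1 0 : Finset ℕ) = ∅ by decide, Finset.prod_empty]

/-- `Π_{k+1} = Π_k · X_{k+1}`. [cite: Fischler2002Polyzetas, §2 p. 2 (definition of 𝓛(P))] -/
theorem headProduct_succ {m : ℕ} (X : Fin m → ℝ) (k : ℕ) : headProduct X (k + 1) = headProduct X k * coord X (k + 1) := by
  unfold headProduct
  rw [Finset.prod_Icc_succ_top (by omega : 1 ≤ k + 1)]

/-- On the open cube `0 < Π_k ≤ 1`, and `Π_k < 1` for `k ≥ 1` (`k ≤ m`). [cite: Fischler2002Polyzetas, §2 p. 2 (definition of 𝓛(P))] -/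
theorem headProduct_mem {m : ℕ} {X : Fin m → ℝ} (hX : ∀ i, 0 < X i ∧ X i < 1) :
    ∀ k : ℕ, k ≤ m → 0 < headProduct X k ∧ headProduct X k ≤ 1 ∧ (1 ≤ k → headProduct X k < 1)
  | 0, _ => by rw [headProduct_zero]; exact ⟨one_pos, le_rfl, fun h => absurd h (by omega)⟩
  | k + 1, hk => by
      obtain ⟨h0, h1, -⟩ := headProduct_mem hX k (by omega)
      have hc : 0 < coord X (k + 1) ∧ coord X (k + 1) < 1 := by
        unfold coord
        rw [dif_pos ⟨by omega, hk⟩]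
        exact hX _
      rw [headProduct_succ]
      refine ⟨mul_pos h0 hc.1, ?_, fun _ => ?_⟩
      · nlinarith [mul_le_mul h1 hc.2.le hc.1.le zero_le_one]
      · nlinarith [mul_lt_mul' h1 hc.2 hc.1.le one_pos]

/-- For `k ≤ m`, `Π_k(X′, t) = Π_k(X′)`. [cite: Fischler2002Polyzetas, §2 p. 2 (definition of 𝓛(P))] -/
theorem headProduct_snoc_of_le {m : ℕ} (X' : Fin m → ℝ) (t : ℝ) {k : ℕ} (hk : k ≤ m) :
    headProduct (Fin.snoc X' t : Fin (m + 1) → ℝ) k = headProduct X' k :=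
  Finset.prod_congr rfl fun i hi => coord_snoc_of_le X' t (by have := (Finset.mem_Icc.1 hi).2; omega)

/-- `Π_{m+1}(X′, t) = Π_m(X′)·t`. [cite: Fischler2002Polyzetas, §2 p. 2 (definition of 𝓛(P))] -/
theorem headProduct_snoc_last {m : ℕ} (X' : Fin m → ℝ) (t : ℝ) :
    headProduct (Fin.snoc X' t : Fin (m + 1) → ℝ) (m + 1) = headProduct X' m * t := by
  rw [headProduct_succ, coord_snoc_last, headProduct_snoc_of_le X' t le_rfl]

/-- `X ↦ Π_k(X)` is measurable. [cite: Fischler2002Polyzetas, §2 p. 2 (definition of 𝓛(P))] -/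
theorem measurable_headProduct {m : ℕ} (k : ℕ) : Measurable fun X : Fin m → ℝ => headProduct X k :=
  Finset.measurable_prod _ fun i _ => measurable_coord i

/-! ### The one-dimensional Möbius substitution `s = (1−q)t/(1−qt)` -/

/-- For `0 ≤ q < 1`: `∫⁻_{s∈(0,1)} h(s) = ∫⁻_{t∈(0,1)} (1−q)/(1−qt)² · h((1−q)t/(1−qt))` (a Möbius self-map of `(0,1)`).
[cite: Fischler2002Polyzetas, §2 Théorème 2.1 (changement de variables)] -/
theorem lintegral_Ioo_moebius {q : ℝ} (hq0 : 0 ≤ q) (hq1 : q < 1) (h : ℝ → ℝ≥0∞) :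
    ∫⁻ s in Ioo (0:ℝ) 1, h s =
      ∫⁻ t in Ioo (0:ℝ) 1, ENNReal.ofReal ((1 - q) / (1 - q * t) ^ 2) * h ((1 - q) * t / (1 - q * t)) := by
  have hden : ∀ t : ℝ, t ≤ 1 → 0 < 1 - q * t := fun t ht => by nlinarith [mul_le_mul_of_nonneg_left ht hq0]
  have himg : (fun t : ℝ => (1 - q) * t / (1 - q * t)) '' Set.Ioo (0:ℝ) 1 = Set.Ioo 0 1 := by
    ext s
    simp only [Set.mem_image, Set.mem_Ioo]
    constructor
    · rintro ⟨t, ⟨ht0, ht1⟩, rfl⟩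
      have hd := hden t ht1.le
      refine ⟨div_pos (mul_pos (by linarith) ht0) hd, ?_⟩
      rw [div_lt_one hd]
      nlinarith
    · rintro ⟨hs0, hs1⟩
      have hD : 0 < 1 - q + q * s := by nlinarith
      refine ⟨s / (1 - q + q * s), ⟨div_pos hs0 hD, ?_⟩, ?_⟩
      · rw [div_lt_one hD]
        nlinarith
      · have h1 : 1 - q * (s / (1 - q + q * s)) = (1 - q) / (1 - q + q * s) := by
          field_simp
          ring
        rw [h1]
        have hq' : (1 : ℝ) - q ≠ 0 := by linarith
        field_simp
  have hderiv : ∀ t ∈ Ioo (0:ℝ) 1,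
      HasDerivWithinAt (fun t : ℝ => (1 - q) * t / (1 - q * t)) ((1 - q) / (1 - q * t) ^ 2) (Ioo (0:ℝ) 1) t := by
    intro t ht
    have hd := hden t ht.2.le
    have h1 : HasDerivAt (fun t : ℝ => (1 - q) * t / (1 - q * t))
        (((1 - q) * 1 * (1 - q * t) - (1 - q) * t * (-(q * 1))) / (1 - q * t) ^ 2) t :=
      ((hasDerivAt_id t).const_mul (1 - q)).div (((hasDerivAt_id t).const_mul q).const_sub 1) hd.ne'
    have h2 : ((1 - q) * 1 * (1 - q * t) - (1 - q) * t * (-(q * 1))) / (1 - q * t) ^ 2 = (1 - q) / (1 - q * t) ^ 2 := by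
      field_simp
      ring
    rw [h2] at h1
    exact h1.hasDerivWithinAt
  have hinj : InjOn (fun t : ℝ => (1 - q) * t / (1 - q * t)) (Ioo (0:ℝ) 1) := by
    intro t₁ ht₁ t₂ ht₂ h12
    have hd₁ := hden t₁ ht₁.2.le
    have hd₂ := hden t₂ ht₂.2.le
    simp only at h12
    rw [div_eq_div_iff hd₁.ne' hd₂.ne'] at h12
    have hq : (1 - q) * (t₁ - t₂) = 0 := by linear_combination h12
    rcases mul_eq_zero.1 hq with h | h
    · exact absurd h (by linarith)
    · linarith
  have key := lintegral_image_eq_lintegral_abs_deriv_mul measurableSet_Ioo hderiv hinj h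
  rw [himg] at key
  rw [key]
  refine setLIntegral_congr_fun measurableSet_Ioo fun t ht => ?_
  rw [abs_of_pos (div_pos (by linarith) (pow_pos (hden t ht.2.le) 2))]

/-! ### The triangular Möbius map of the cube and its Jacobian weight -/

/-- The map `Y` splits along the last coordinate: `Y(X′, t) = (Y(X′), t)` if `m+1` is odd, `(Y(X′), (1−Π_m)t/(1−Π_m t))` if
`m+1` is even. [cite: Fischler2002Polyzetas, §2 Théorème 2.1 (changement de variables)] -/
theorem moebiusMap_snoc {m : ℕ} (X' : Fin m → ℝ) (t : ℝ) :
    (fun i : Fin (m + 1) => if Even (i.1 + 1) then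
        (1 - headProduct (Fin.snoc X' t : Fin (m + 1) → ℝ) i.1) * (Fin.snoc X' t : Fin (m + 1) → ℝ) i /
          (1 - headProduct (Fin.snoc X' t : Fin (m + 1) → ℝ) (i.1 + 1))
      else (Fin.snoc X' t : Fin (m + 1) → ℝ) i) =
      Fin.snoc (fun i : Fin m => if Even (i.1 + 1) then
          (1 - headProduct X' i.1) * X' i / (1 - headProduct X' (i.1 + 1)) else X' i)
        (if Even (m + 1) then (1 - headProduct X' m) * t / (1 - headProduct X' m * t) else t) := by
  funext i
  by_cases hi : i = Fin.last m
  · subst hi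
    rw [Fin.snoc_last, Fin.val_last, Fin.snoc_last, headProduct_snoc_of_le X' t le_rfl, headProduct_snoc_last]
  · obtain ⟨j, rfl⟩ : ∃ j : Fin m, i = Fin.castSucc j := ⟨i.castPred hi, (Fin.castSucc_castPred i hi).symm⟩
    have hj := j.2
    rw [Fin.snoc_castSucc, Fin.snoc_castSucc, Fin.val_castSucc, headProduct_snoc_of_le X' t (by omega),
      headProduct_snoc_of_le X' t (by omega)]

/-- The Jacobian weight splits along the last coordinate: `W(X′, t) = W(X′)` if `m+1` is odd, `W(X′)·(1−Π_m)/(1−Π_m t)²` if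
`m+1` is even. [cite: Fischler2002Polyzetas, §2 Théorème 2.1 (changement de variables)] -/
theorem weight_snoc {m : ℕ} (X' : Fin m → ℝ) (t : ℝ) :
    (∏ j ∈ Finset.Icc 1 (m + 1), if Even j then
        (1 - headProduct (Fin.snoc X' t : Fin (m + 1) → ℝ) (j - 1)) / (1 - headProduct (Fin.snoc X' t : Fin (m + 1) → ℝ) j) ^ 2
      else 1) =
      (∏ j ∈ Finset.Icc 1 m, if Even j then (1 - headProduct X' (j - 1)) / (1 - headProduct X' j) ^ 2 else 1) *
        (if Even (m + 1) then (1 - headProduct X' m) / (1 - headProduct X' m * t) ^ 2 else 1) := by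
  rw [Finset.prod_Icc_succ_top (by omega : 1 ≤ m + 1), Nat.add_sub_cancel, headProduct_snoc_of_le X' t le_rfl,
    headProduct_snoc_last]
  congr 1
  exact Finset.prod_congr rfl fun j hj => by
    have hj' := Finset.mem_Icc.1 hj
    rw [headProduct_snoc_of_le X' t (by omega : j - 1 ≤ m), headProduct_snoc_of_le X' t hj'.2]

/-- The map `Y` is measurable. [cite: Fischler2002Polyzetas, §2 Théorème 2.1 (changement de variables)] -/
theorem measurable_moebiusMap (n : ℕ) :
    Measurable fun X : Fin n → ℝ => fun i : Fin n =>
      if Even (i.1 + 1) then (1 - headProduct X i.1) * X i / (1 - headProduct X (i.1 + 1)) else X i := by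
  refine measurable_pi_lambda _ fun i => ?_
  by_cases h : Even (i.1 + 1)
  · simp only [if_pos h]
    exact ((measurable_const.sub (measurable_headProduct _)).mul (measurable_pi_apply i)).div
      (measurable_const.sub (measurable_headProduct _))
  · simp only [if_neg h]
    exact measurable_pi_apply i

/-- The Jacobian weight is measurable. [cite: Fischler2002Polyzetas, §2 Théorème 2.1 (changement de variables)] -/
theorem measurable_weight (n : ℕ) :
    Measurable fun X : Fin n → ℝ =>
      ∏ j ∈ Finset.Icc 1 n, if Even j then (1 - headProduct X (j - 1)) / (1 - headProduct X j) ^ 2 else (1:ℝ) := by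
  refine Finset.measurable_prod _ fun j _ => ?_
  by_cases h : Even j
  · simp only [if_pos h]
    exact (measurable_const.sub (measurable_headProduct _)).div ((measurable_const.sub (measurable_headProduct _)).pow_const _)
  · simp only [if_neg h]
    exact measurable_const

/-- The Jacobian weight is positive on the open cube. [cite: Fischler2002Polyzetas, §2 Théorème 2.1 (changement de variables)] -/
theorem weight_pos {m : ℕ} {X : Fin m → ℝ} (hX : ∀ i, 0 < X i ∧ X i < 1) :
    0 < ∏ j ∈ Finset.Icc 1 m, if Even j then (1 - headProduct X (j - 1)) / (1 - headProduct X j) ^ 2 else (1:ℝ) := by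
  refine Finset.prod_pos fun j hj => ?_
  have hj' := Finset.mem_Icc.1 hj
  by_cases h : Even j
  · rw [if_pos h]
    have h2 : 2 ≤ j := by obtain ⟨r, hr⟩ := h; omega
    have hA := (headProduct_mem hX (j - 1) (by omega)).2.2 (by omega)
    have hB := (headProduct_mem hX j hj'.2).2.2 hj'.1
    exact div_pos (by linarith) (pow_pos (by linarith) 2)
  · rw [if_neg h]
    exact one_pos

/-! ### The substitution theorem -/

/-- **Substitution theorem for Fischler's change of variables** (Théorème 2.1, in the reversed variables): for every `n` and
every measurable `G : ℝ^n → [0,∞]`,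
`∫⁻_{(0,1)^n} G(y) dy = ∫⁻_{(0,1)^n} G(Y(X)) · ∏_{j ≤ n, j even} (1 − Π_{j−1})/(1 − Π_j)² dX`,
`Y(X)_j = X_j` (`j` odd), `(1 − Π_{j−1})X_j/(1 − Π_j)` (`j` even), `Π_j = X₁⋯X_j`. By induction on `n`, splitting off the last
variable on both sides (Tonelli); when `n` is even the last variable undergoes the Möbius substitution `lintegral_Ioo_moebius`
with `q = Π_{n−1}(X′)` — no `n × n` Jacobian is computed. [cite: Fischler2002Polyzetas, §2 Théorème 2.1 (changement de variables)] [cite: Fischler2003RhinViola, §5 (proof of Théorème 2.1)] -/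
theorem lintegral_cube_eq_lintegral_moebius (n : ℕ) (G : (Fin n → ℝ) → ℝ≥0∞) (hG : Measurable G) :
    ∫⁻ y in Set.pi Set.univ (fun _ : Fin n => Ioo (0:ℝ) 1), G y =
      ∫⁻ X in Set.pi Set.univ (fun _ : Fin n => Ioo (0:ℝ) 1),
        G (fun i : Fin n => if Even (i.1 + 1) then (1 - headProduct X i.1) * X i / (1 - headProduct X (i.1 + 1)) else X i) *
          ENNReal.ofReal (∏ j ∈ Finset.Icc 1 n,
            if Even j then (1 - headProduct X (j - 1)) / (1 - headProduct X j) ^ 2 else (1:ℝ)) := by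
  induction n with
  | zero =>
    refine setLIntegral_congr_fun (measurableSet_openCube 0) fun y _ => ?_
    rw [show (Finset.Icc 1 0 : Finset ℕ) = ∅ by decide, Finset.prod_empty, ENNReal.ofReal_one, mul_one]
    congr 1
    exact Subsingleton.elim _ _
  | succ m ih =>
    set Φ : (Fin m → ℝ) → ℝ≥0∞ := fun y' => ∫⁻ s in Ioo (0:ℝ) 1, G (Fin.snoc y' s) with hΦ
    have hΦmeas : Measurable Φ :=
      (hG.comp measurable_snoc_prod).lintegral_prod_right' (ν := (volume : Measure ℝ).restrict (Ioo (0:ℝ) 1))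
    have hmeas : Measurable fun X : Fin (m + 1) → ℝ =>
        G (fun i : Fin (m + 1) => if Even (i.1 + 1) then (1 - headProduct X i.1) * X i / (1 - headProduct X (i.1 + 1))
            else X i) *
          ENNReal.ofReal (∏ j ∈ Finset.Icc 1 (m + 1),
            if Even j then (1 - headProduct X (j - 1)) / (1 - headProduct X j) ^ 2 else (1:ℝ)) :=
      (hG.comp (measurable_moebiusMap (m + 1))).mul (measurable_weight (m + 1)).ennreal_ofReal
    rw [lintegral_openCube_succ _ hG, lintegral_openCube_succ _ hmeas]
    rw [show (∫⁻ y' in Set.pi Set.univ (fun _ : Fin m => Ioo (0:ℝ) 1), ∫⁻ s in Ioo (0:ℝ) 1, G (Fin.snoc y' s)) =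
        ∫⁻ y' in Set.pi Set.univ (fun _ : Fin m => Ioo (0:ℝ) 1), Φ y' from rfl, ih Φ hΦmeas]
    refine setLIntegral_congr_fun (measurableSet_openCube m) fun X' hX' => ?_
    have hX : ∀ i, 0 < X' i ∧ X' i < 1 := fun i => hX' i (Set.mem_univ _)
    have hWpos := weight_pos hX
    simp only [moebiusMap_snoc, weight_snoc]
    rcases Nat.even_or_odd (m + 1) with hev | hodd
    · -- `m + 1` even: Möbius in the last variable, `q = Π_m(X′) ∈ (0,1)` (`m ≥ 1`)
      have hm : 1 ≤ m := by obtain ⟨r, hr⟩ := hev; omega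
      have hq := headProduct_mem hX m le_rfl
      simp only [if_pos hev]
      rw [hΦ]
      simp only
      rw [lintegral_Ioo_moebius hq.1.le (hq.2.2 hm) (fun s => G (Fin.snoc _ s))]
      have hre : ∀ t : ℝ,
          G (Fin.snoc (fun i : Fin m => if Even (i.1 + 1) then (1 - headProduct X' i.1) * X' i / (1 - headProduct X' (i.1 + 1))
              else X' i) ((1 - headProduct X' m) * t / (1 - headProduct X' m * t))) *
            ENNReal.ofReal ((∏ j ∈ Finset.Icc 1 m,
                if Even j then (1 - headProduct X' (j - 1)) / (1 - headProduct X' j) ^ 2 else (1:ℝ)) *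
              ((1 - headProduct X' m) / (1 - headProduct X' m * t) ^ 2)) =
          ENNReal.ofReal ((1 - headProduct X' m) / (1 - headProduct X' m * t) ^ 2) *
              G (Fin.snoc (fun i : Fin m => if Even (i.1 + 1) then
                  (1 - headProduct X' i.1) * X' i / (1 - headProduct X' (i.1 + 1)) else X' i)
                ((1 - headProduct X' m) * t / (1 - headProduct X' m * t))) *
            ENNReal.ofReal (∏ j ∈ Finset.Icc 1 m,
              if Even j then (1 - headProduct X' (j - 1)) / (1 - headProduct X' j) ^ 2 else (1:ℝ)) := by
        intro t
        rw [ENNReal.ofReal_mul hWpos.le]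
        ring
      simp only [hre]
      rw [lintegral_mul_const' _ _ ENNReal.ofReal_ne_top]
    · -- `m + 1` odd: the last variable is unchanged
      have hnev : ¬ Even (m + 1) := Nat.not_even_iff_odd.mpr hodd
      simp only [if_neg hnev, mul_one]
      rw [hΦ]
      simp only
      rw [lintegral_mul_const' _ _ ENNReal.ofReal_ne_top]

/-! ### Reversal invariance of the cube -/

/-- **The open cube and its volume are invariant under the coordinate reversal**: for every `G ≥ 0`,
`∫⁻_{(0,1)^n} G(x) dx = ∫⁻_{(0,1)^n} G(x ∘ rev) dx`. [cite: Fischler2002Polyzetas, §2 Théorème 2.1 (x_k = X_{n+1−k})] -/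
theorem lintegral_cube_rev (n : ℕ) (G : (Fin n → ℝ) → ℝ≥0∞) :
    ∫⁻ x in Set.pi Set.univ (fun _ : Fin n => Ioo (0:ℝ) 1), G x =
      ∫⁻ x in Set.pi Set.univ (fun _ : Fin n => Ioo (0:ℝ) 1), G (fun i => x (Fin.rev i)) := by
  set C := Set.pi Set.univ (fun _ : Fin n => Ioo (0:ℝ) 1) with hC
  set e := MeasurableEquiv.piCongrLeft (fun _ : Fin n => ℝ) Fin.revPerm with he
  have hmp : MeasurePreserving e volume volume :=
    volume_measurePreserving_piCongrLeft (fun _ : Fin n => ℝ) Fin.revPerm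
  have he' : ∀ u : Fin n → ℝ, e u = fun i => u (Fin.rev i) := by
    intro u
    funext i
    simp only [he, MeasurableEquiv.coe_piCongrLeft, Equiv.piCongrLeft_apply, eq_rec_constant, Fin.revPerm_symm,
      Fin.revPerm_apply]
  have hpre : e ⁻¹' C = C := by
    ext u
    simp only [Set.mem_preimage, he', hC, Set.mem_univ_pi]
    exact ⟨fun h i => by simpa using h (Fin.rev i), fun h i => h (Fin.rev i)⟩
  have h := hmp.setLIntegral_comp_preimage_emb e.measurableEmbedding G C
  rw [hpre] at h
  rw [← h]
  exact lintegral_congr fun u => by rw [he']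

end KL

end Literature.NumberTheory.Irrationality.Fischler2002

end
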